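import Literature.AlgebraicGeometry.Resolution.ArithmeticalThreefoldsResidualLU
import Literature.AlgebraicGeometry.Resolution.ArithmeticalThreefoldsBoundedCentreRegular
import Literature.AlgebraicGeometry.Resolution.ArithmeticalThreefoldsDescentHeadChoice
import Literature.AlgebraicGeometry.Resolution.ValuationExtensionToCompletion
import Literature.AlgebraicGeometry.Resolution.ValueGroupRankDataTrdeg
import Literature.AlgebraicGeometry.Resolution.FormalEquidimensionality
import Literature.AlgebraicGeometry.Resolution.AffineDomainDimension
import HarnessLib

/-!
# Cossart–Piltant 2019, Prop. 4.8 at rank one, IN KERNEL modulo (LU) for the formal quotients: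
# (LU) for `B_𝔭` from embedded resolution of surfaces and (LU) for the local domains `Â/Q`

Topic: `Literature/AlgebraicGeometry/Resolution` (proofs only; no new notions, no new named
facts). The geometric head of Cossart–Piltant's descent (J. Algebra 529 (2019) =
arXiv:1412.0868, Prop. 4.8 with Lemma 4.7 and (510)–(512); arXiv v1 Prop. 4.6, pp. 52–53)
assembled for the local rings `A = B_𝔭` (`B` a domain of finite type over a field `k`,
`dim B_𝔭 = 3`) along RANK-ONE valuations with algebraic residues, from exactly two inputs:

* `hEmb` — embedded resolution of two-dimensional closed subsets of regular excellent schemes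
  (Cossart–Jannsen–Saito, Cor. 1.5), used by the monomialization of Lemma 4.7;
* `hLUq` — Cossart–Piltant's property (LU) (`CPLocalUniformization`) for every local domain
  that is a quotient of the completion `Â` (in the source: "theorem 1.1 holds for `X̂ = Spec Â`";
  here only LOCAL UNIFORMIZATION of the formal branches and of the lower-dimensional quotients
  `Â/P∞` is used — no patching over `Spec Â`).

Chain: extension of `v` to a formal branch `K̂₁ = Frac(Â/P̂₁)`
(`exists_minimalPrime_valuationSubring_adicCompletion`), `dim Â/P̂₁ = 3` (formal
equidimensionality), rank data by Abhyankar's inequality (`exists_rank_data_of_trdeg_le`), the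
`K`-bounded coarsening `O₁` of `v̂` and regularity of `Â/P̂₁` at its centre `P∞`
(`isRegularLocalRing_localization_centre_boundedBy`), Novacoski–Spivakovsky's residual
hypothesis from (LU) for `Â/P∞` (`residualLU_of_cpLocalUniformization`), the regular model with
`K`-finite denominators and the descent (`exists_adjoin_isRegularLocalRing_of_residualLU`).

* `exists_adjoin_isRegularLocalRing_rankOne_of_quotientLU` — (LU) for `B_𝔭` at a rank-one `O`;
* `localUniformization3_of_quotientLU` — `LocalUniformization3 k` from surface resolution over
  `k` (`CossartJannsenSaito2020`), `hEmb`, and `hLUq` for all `B_𝔭` over `k`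
  (`localUniformization3_of_closedPoints_rankOne_over`, Novacoski–Spivakovsky in transcendence
  degree `≤ 3`).

## Sources

* V. Cossart, O. Piltant, J. Algebra 529 (2019) 268–535 = arXiv:1412.0868, §4.1 and proof of
  Prop. 4.8 with Lemma 4.7 (arXiv v1: Prop. 4.6, pp. 52–53). [CossartPiltant2019]
* J. Novacoski, M. Spivakovsky, arXiv:1204.4751v1, Thm. 1.1, Cor. 2.17, §3.1.
  [NovacoskiSpivakovsky2014]
* V. Cossart, U. Jannsen, S. Saito (2020), Cor. 1.5. [CossartJannsenSaito2020]
-/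

noncomputable section

open AlgebraicGeometry CategoryTheory

namespace Literature.AlgebraicGeometry.Resolution

universe u

open IsLocalRing _root_.Polynomial Function

section QuotientLU

set_option maxHeartbeats 1600000 in
/-- **(LU) for `B_𝔭` along a rank-one valuation from `hEmb` and (LU) for the quotients of
`B̂_𝔭`** (Cossart–Piltant 2019, Prop. 4.8, geometric head, with the model built by
Novacoski–Spivakovsky's composite lifting). Let `B` be a domain of finite type over a field
`k`, `𝔭` a prime with `dim B_𝔭 = 3`, `K = Frac B_𝔭`, `O` a rank-one valuation ring of `K`
containing and dominating `B_𝔭` with residues algebraic over it. Assume embedded resolution of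
surfaces (`hEmb`, CJS Cor. 1.5) and (LU) (`CPLocalUniformization`) for every local domain that
is a homomorphic image of the completion `B̂_𝔭`. Then some finitely generated `B_𝔭[s] ⊆ O` is
regular at the centre of `O`.
[cite: CossartPiltant2019, proof of Prop. 4.8 with Lemma 4.7 and (510)–(512) (arXiv v1: Prop. 4.6, pp. 52–53)]
[cite: NovacoskiSpivakovsky2014, Cor. 2.17 and §3.1] -/
theorem exists_adjoin_isRegularLocalRing_rankOne_of_quotientLU
    {k B : Type u} [Field k] [CommRing B] [IsDomain B] [Algebra k B] [Algebra.FiniteType k B]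
    (hEmb : ∀ (Z : Scheme.{u}) [IsIntegral Z] [IsNoetherian Z], Scheme.IsRegular Z →
      Scheme.IsExcellent Z → ∀ (X : Set Z), IsClosed X → X ≠ Set.univ → topologicalKrullDim X ≤ 2 →
        ∃ (Z' : Scheme.{u}) (π : Z' ⟶ Z), IsProper π ∧ Function.Surjective π.base ∧
          (∃ U : Z.Opens, (U : Set Z) = Xᶜ ∧ IsIso (π ∣_ U)) ∧
          IsStrictNormalCrossingsDivisor Z' (π.base ⁻¹' X))
    (p : Ideal B) [p.IsPrime] (hdim : ringKrullDim (Localization.AtPrime p) = 3)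
    {K : Type u} [Field K] [Algebra (Localization.AtPrime p) K]
    [IsFractionRing (Localization.AtPrime p) K] (O : ValuationSubring K)
    (hrk : Nonempty O.valuation.RankOne)
    (hAO : ∀ a : Localization.AtPrime p, algebraMap _ K a ∈ O)
    (hdom : ∀ a ∈ maximalIdeal (Localization.AtPrime p), O.valuation (algebraMap _ K a) < 1)
    (halg : ∀ x : O, ∃ q : (Localization.AtPrime p)[X],
      (∃ i, q.coeff i ∉ maximalIdeal (Localization.AtPrime p)) ∧
        O.valuation (q.eval₂ (algebraMap _ K) x) < 1)
    (hLUq : ∀ (R : Type u) [CommRing R] [IsDomain R] [IsLocalRing R]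
      (π : AdicCompletion (maximalIdeal (Localization.AtPrime p)) (Localization.AtPrime p) →+* R),
      Function.Surjective π → CPLocalUniformization R) :
    ∃ (s : Finset K) (h : (Algebra.adjoin (Localization.AtPrime p) (s : Set K)).toSubring ≤
        O.toSubring),
      IsRegularLocalRing (Localization.AtPrime
        (Ideal.comap (Subring.inclusion h) (maximalIdeal O))) := by
  classical
  set A := Localization.AtPrime p with hAdef
  haveI : IsNoetherianRing B := Algebra.FiniteType.isNoetherianRing k B
  haveI : IsNoetherianRing A := IsLocalization.isNoetherianRing p.primeCompl _ inferInstance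
  set Ah := AdicCompletion (maximalIdeal A) A with hAhdef
  haveI : IsNoetherianRing Ah := isNoetherianRing_adicCompletion_maximalIdeal A
  -- Step A: a minimal prime `P` of `Â` with `P ∩ A = 0` carrying an extension of `v`
  obtain ⟨P, hPmin, hPA, H⟩ :=
    exists_minimalPrime_valuationSubring_adicCompletion.{u, u, u} O hAO hdom halg
  haveI hPprime : P.IsPrime := hPmin.1.1
  haveI : IsLocalRing (Ah ⧸ P) :=
    IsLocalRing.of_surjective' (Ideal.Quotient.mk P) Ideal.Quotient.mk_surjective
  haveI : IsLocalHom (Ideal.Quotient.mk P) :=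
    IsLocalHom.of_surjective _ Ideal.Quotient.mk_surjective
  set K₁ := FractionRing (Ah ⧸ P) with hK₁def
  have hRK₁ : Function.Injective (algebraMap (Ah ⧸ P) K₁) := IsFractionRing.injective _ _
  have halgmap : ∀ x : Ah, algebraMap Ah K₁ x = algebraMap (Ah ⧸ P) K₁ (Ideal.Quotient.mk P x) :=
    fun x => IsScalarTower.algebraMap_apply Ah (Ah ⧸ P) K₁ x
  have hker : RingHom.ker (algebraMap Ah K₁) = P := by
    ext x
    rw [RingHom.mem_ker, halgmap, map_eq_zero_iff _ hRK₁, Ideal.Quotient.eq_zero_iff_mem]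
  have hP₁ : RingHom.ker (algebraMap Ah K₁) ∈ minimalPrimes Ah := by rw [hker]; exact hPmin
  have hK₁ : ∀ z : K₁, ∃ a b : Ah, z = algebraMap _ K₁ a / algebraMap _ K₁ b := by
    intro z
    obtain ⟨a, b, -, rfl⟩ := IsFractionRing.div_surjective (A := Ah ⧸ P) z
    obtain ⟨a', rfl⟩ := Ideal.Quotient.mk_surjective a
    obtain ⟨b', rfl⟩ := Ideal.Quotient.mk_surjective b
    exact ⟨a', b', by rw [halgmap, halgmap]⟩
  have hinjA : Function.Injective ((algebraMap Ah K₁).comp (algebraMap A Ah)) := by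
    rw [injective_iff_map_eq_zero]
    intro x hx
    rw [RingHom.comp_apply] at hx
    have h1 : algebraMap A Ah x ∈ RingHom.ker (algebraMap Ah K₁) := RingHom.mem_ker.mpr hx
    rw [hker] at h1
    have h2 : x ∈ P.comap (algebraMap A Ah) := Ideal.mem_comap.mpr h1
    rwa [hPA, Ideal.mem_bot] at h2
  obtain ⟨ι, hι⟩ : ∃ ι : K →+* K₁,
      ι.comp (algebraMap A K) = (algebraMap Ah K₁).comp (algebraMap A Ah) :=
    ⟨IsFractionRing.lift hinjA, RingHom.ext fun x => by
      rw [RingHom.comp_apply, RingHom.comp_apply]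
      exact IsFractionRing.lift_algebraMap hinjA x⟩
  have hιH : ι.comp (algebraMap A K) =
      (algebraMap (Ah ⧸ P) K₁).comp ((Ideal.Quotient.mk P).comp (algebraMap A Ah)) := by
    rw [hι]
    refine RingHom.ext fun x => ?_
    rw [RingHom.comp_apply, RingHom.comp_apply, RingHom.comp_apply]
    exact halgmap _
  obtain ⟨O', hRO', hdomR, halgR, hcomap⟩ := H (Ah ⧸ P) (Ideal.Quotient.mk P)
    Ideal.Quotient.mk_surjective Ideal.mk_ker K₁ hRK₁ ι hιH
  have hmR : ∀ x ∈ maximalIdeal Ah, Ideal.Quotient.mk P x ∈ maximalIdeal (Ah ⧸ P) := fun x hx =>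
    (IsLocalRing.mem_maximalIdeal _).mpr fun hu =>
      ((IsLocalRing.mem_maximalIdeal x).mp hx) ((isUnit_map_iff (Ideal.Quotient.mk P) x).mp hu)
  have hRO'' : ∀ x : Ah, algebraMap Ah K₁ x ∈ O' := fun x => by rw [halgmap]; exact hRO' _
  have hdomAh : ∀ x ∈ maximalIdeal Ah, O'.valuation (algebraMap Ah K₁ x) < 1 := fun x hx => by
    rw [halgmap]; exact hdomR _ (hmR x hx)
  have hcompR : (algebraMap (Ah ⧸ P) K₁).comp (Ideal.Quotient.mk P) = algebraMap Ah K₁ :=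
    RingHom.ext fun x => (halgmap x).symm
  have halgAh : ∀ y : O', ∃ q : Ah[X], (∃ i, q.coeff i ∉ maximalIdeal Ah) ∧
      O'.valuation (q.eval₂ (algebraMap Ah K₁) y) < 1 := by
    intro y
    obtain ⟨q, ⟨i, hi⟩, hlt⟩ := halgR y
    obtain ⟨q', rfl⟩ :=
      Polynomial.map_surjective (Ideal.Quotient.mk P) Ideal.Quotient.mk_surjective q
    refine ⟨q', ⟨i, fun hqi => hi ?_⟩, ?_⟩
    · rw [Polynomial.coeff_map]; exact hmR _ hqi
    · rwa [Polynomial.eval₂_map, hcompR] at hlt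
  have halg'' : ∀ y : O', ∃ q : Ah[X],
      (∃ i, q.coeff i ∉ (maximalIdeal A).map (algebraMap A Ah)) ∧
      O'.valuation (q.eval₂ (algebraMap Ah K₁) y) < 1 := by
    intro y
    obtain ⟨q, ⟨i, hi⟩, hlt⟩ := halgAh y
    exact ⟨q, ⟨i, by rw [← AdicCompletion.maximalIdeal_eq_map]; exact hi⟩, hlt⟩
  -- `dim Â/P̂₁ = 3` (formal equidimensionality over a field)
  have hdimP₁ : ringKrullDim (Ah ⧸ RingHom.ker (algebraMap Ah K₁)) = 3 := by
    rw [hker, ringKrullDim_quotient_eq_of_mem_minimalPrimes_adicCompletion_localization k p P hPmin]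
    exact hdim
  -- rank data by Abhyankar's inequality
  letI : Algebra k K := ((algebraMap A K).comp (algebraMap k A)).toAlgebra
  haveI : IsScalarTower k A K := IsScalarTower.of_algebraMap_eq fun _ => rfl
  haveI : FaithfulSMul A K := (faithfulSMul_iff_algebraMap_injective A K).mpr
    (IsFractionRing.injective A K)
  haveI : FaithfulSMul B A := (faithfulSMul_iff_algebraMap_injective B A).mpr
    (IsLocalization.injective A p.primeCompl_le_nonZeroDivisors)
  haveI : FaithfulSMul k B := (faithfulSMul_iff_algebraMap_injective k B).mpr
    (algebraMap k B).injective
  haveI : FaithfulSMul k A := (faithfulSMul_iff_algebraMap_injective k A).mpr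
    (algebraMap k A).injective
  haveI : Algebra.IsAlgebraic B A := IsLocalization.isAlgebraic A p.primeCompl
  haveI : Algebra.IsAlgebraic A K := IsLocalization.isAlgebraic K (nonZeroDivisors A)
  obtain ⟨n, -, htrB⟩ := exists_ringKrullDim_eq_and_trdeg_eq k B
  have htrA : Algebra.trdeg k A = Algebra.trdeg k B := by
    rw [← trdeg_add_eq k B (A := A), trdeg_eq_zero (R := B) (A := A), add_zero]
  have htrK : Algebra.trdeg k K ≤ n := by
    rw [← trdeg_add_eq k A (A := K), trdeg_eq_zero (R := A) (A := K), add_zero,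
      htrA, htrB]
  have hkO : ∀ c : k, algebraMap k K c ∈ O := fun c => hAO (algebraMap k A c)
  have hne : ∃ s : A, algebraMap A K s ≠ 0 ∧ O.valuation (algebraMap A K s) < 1 := by
    by_contra hne
    have hm : maximalIdeal A = ⊥ := by
      refine le_bot_iff.mp fun s hs => ?_
      rw [Ideal.mem_bot]
      by_contra hs0
      exact hne ⟨s, (map_ne_zero_iff _ (IsFractionRing.injective A K)).mpr hs0, hdom s hs⟩
    have hf : IsField A := (IsLocalRing.isField_iff_maximalIdeal_eq).mpr hm
    have h0 : ringKrullDim A = 0 := by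
      letI := hf.toField
      exact ringKrullDim_eq_zero_of_field A
    rw [h0] at hdim
    exact absurd hdim (by decide)
  obtain ⟨r, fA, hr0, -, hfA0', hind, -, hdepK⟩ :=
    exists_rank_data_of_trdeg_le (S := A) (E := K) k O hkO n htrK (IsFractionRing.injective A K) hne
  have hfA0 : ∀ i, algebraMap A K (fA i) ≠ 0 := fun i =>
    (map_ne_zero_iff _ (IsFractionRing.injective A K)).mpr (hfA0' i)
  have hfAm : ∀ i, fA i ∈ maximalIdeal A := by
    intro i
    by_contra hi
    have hu : IsUnit (fA i) := by
      by_contra hnu; exact hi ((IsLocalRing.mem_maximalIdeal _).mpr (mem_nonunits_iff.mpr hnu))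
    have hv1 : O.valuation (algebraMap A K (fA i)) = 1 := by
      obtain ⟨u, hu⟩ := hu
      have h1 : O.valuation (algebraMap A K (fA i)) ≤ 1 := (O.valuation_le_one_iff _).mpr (hAO _)
      have h2 : O.valuation (algebraMap A K ↑u⁻¹) ≤ 1 := (O.valuation_le_one_iff _).mpr (hAO _)
      have h3 : O.valuation (algebraMap A K (fA i)) * O.valuation (algebraMap A K ↑u⁻¹) = 1 := by
        rw [← map_mul, ← map_mul, ← hu, Units.mul_inv, map_one, map_one]
      exact le_antisymm h1 (by
        by_contra hlt
        push Not at hlt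
        have := mul_lt_one_of_lt_of_le hlt h2
        rw [h3] at this; exact lt_irrefl _ this)
    have := hind (Pi.single i 1) 0 (by
      simp only [Pi.zero_apply, pow_zero, Finset.prod_const_one]
      rw [Finset.prod_eq_single i (fun j _ hj => by rw [Pi.single_eq_of_ne hj, pow_zero])
        (fun h => absurd (Finset.mem_univ i) h), Pi.single_eq_same, pow_one, hv1])
    have := congrFun this i
    simp at this
  -- the `K`-bounded coarsening and the leaves
  obtain ⟨O₁, hO'O₁, hO₁⟩ := exists_valuationSubring_boundedBy O' ι
  have hbot : (⊥ : Subalgebra Ah K₁).toSubring ≤ O'.toSubring := by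
    intro x hx
    obtain ⟨a, rfl⟩ := Set.mem_range.mp (Algebra.mem_bot.mp hx)
    exact hRO'' a
  have hregP := isRegularLocalRing_localization_centre_boundedBy k hP₁ ι hι O' O₁ hO₁
    (hbot.trans hO'O₁)
  have h₂ := residualLU_of_cpLocalUniformization O' O₁ hO'O₁ hbot hdomAh halgAh
    (fun D _ _ _ π hπ _ => hLUq D π hπ)
  exact exists_adjoin_isRegularLocalRing_of_residualLU k hEmb O hrk hAO hdom r hr0 fA hfAm hfA0
    hind hdepK hP₁ hK₁ hdimP₁ ι hι O' hRO'' halg'' hcomap O₁ hO'O₁ hO₁ hbot hregP h₂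


/-- **`LocalUniformization3 k` from surface resolution, `hEmb`, and (LU) for the quotients of
the completed local rings `B̂_𝔭`** (Cossart–Piltant 2019, Prop. 4.8 at rank one, with
Novacoski–Spivakovsky's induction in transcendence degree `≤ 3` and the closed-points case
analysis of `localUniformization3_of_closedPoints_rankOne_over`): for a field `k`, if reduced
`k`-schemes of dimension `≤ 2` have resolutions (`CossartJannsenSaito2020`), embedded resolution
of surfaces holds (`hEmb`), and for every three-dimensional domain `B` of finite type over `k`
and maximal `𝔭` with `dim B_𝔭 = 3` every local domain that is a homomorphic image of `B̂_𝔭`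
has Cossart–Piltant's property (LU), then `LocalUniformization3 k`.
[cite: CossartPiltant2019, §4.1 (LU) and proof of Prop. 4.8 (arXiv v1: Prop. 4.6, pp. 52–53)]
[cite: NovacoskiSpivakovsky2014, Thm. 1.1] -/
theorem localUniformization3_of_quotientLU (hCJS : CossartJannsenSaito2020.{0})
    (k : Type) [Field k]
    (hEmb : ∀ (Z : Scheme.{0}) [IsIntegral Z] [IsNoetherian Z], Scheme.IsRegular Z →
      Scheme.IsExcellent Z → ∀ (X : Set Z), IsClosed X → X ≠ Set.univ → topologicalKrullDim X ≤ 2 →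
        ∃ (Z' : Scheme.{0}) (π : Z' ⟶ Z), IsProper π ∧ Function.Surjective π.base ∧
          (∃ U : Z.Opens, (U : Set Z) = Xᶜ ∧ IsIso (π ∣_ U)) ∧
          IsStrictNormalCrossingsDivisor Z' (π.base ⁻¹' X))
    (hLUq : ∀ (B : Type) [CommRing B] [IsDomain B] [Algebra k B] [Algebra.FiniteType k B]
      (p : Ideal B) [p.IsMaximal], ringKrullDim B = 3 →
        ringKrullDim (Localization.AtPrime p) = 3 →
      ∀ (R : Type) [CommRing R] [IsDomain R] [IsLocalRing R]
        (π : AdicCompletion (maximalIdeal (Localization.AtPrime p)) (Localization.AtPrime p) →+* R),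
        Function.Surjective π → CPLocalUniformization R) :
    LocalUniformization3 k :=
  localUniformization3_of_closedPoints_rankOne_over hCJS k
    fun B _ _ _ _ p _ h1 h2 _ _ _ _ O hrk hAO hdom halg =>
      exists_adjoin_isRegularLocalRing_rankOne_of_quotientLU (k := k) hEmb p h2 O hrk hAO hdom halg
        (hLUq B p h1 h2)

end QuotientLU

end Literature.AlgebraicGeometry.Resolution

end
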